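import Summits.FinalStateConjecture.FinalStateConjecture.Theorems.SwallowTheDatumKerrShieldedSettlesStubKerrLeafSojournAux1
import Summits.FinalStateConjecture.FinalStateConjecture.Theorems.SwallowTheDatumKerrShieldedSettlesStubCollarEmbedsMGHDAux
import Literature.Geometry.Lorentzian.ExteriorRegionSchwarzschildEnd
import Literature.Geometry.Lorentzian.AsymptoticFlatnessProofs
import Literature.Geometry.Lorentzian.AFEndRestrict
import Literature.Geometry.Lorentzian.KerrDataSchwarzschildMetric
import Literature.Geometry.Lorentzian.FinalState
import Literature.Geometry.Lorentzian.EndVolume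
import HarnessLib

/-!
# `KerrShieldedSettles`, line `tapered-temporal-collar` — stub S5 `stub_scriTransport`, part 2:
# inner-edge capping (`X ∖ φ({r > R})` is compact for an admissible datum)

Support file for crux `stmt-FinalStateConjecture-10054`
(`Summit.FinalStateConjecture.FinalStateConjecture.Theses.SwallowTheDatum.KerrShieldedSettles`), stub S5
`stub_scriTransport`.  The sets `B₀ = X ∖ φ({r > R₀})`, `B₁ = X ∖ φ({r > R₁})` of Christodoulou's sojourn form
of completeness of `𝓘⁺` are compact BECAUSE the datum is admissible (Disproof.lean §H1: for the coreless slice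
they are not).  The proof (`ScriTransport.isCompact_compl_image_far`, registered as `stub_scriTransportCapping`)
compares the two parametrisations of the end of `X` — the chart of the sole asymptotically flat end `e` and the
shield chart `φ` — as the tree compares two structures of infinity in `ExteriorRegionSchwarzschildEnd.lean`:
far regions of `e` are preconnected and eventually avoid the compact set `(range φ)ᶜ ∪ φ({ρ ≤ r ≤ R})`, so a
far region lies in the inner collar `φ({r < ρ})` or in `φ({R < r})`; the first is excluded by VOLUME
(`ScriTransport.not_far_subset_image`: on `{r < ρ ≤ 4M}` the bent leaf is the flat slice, the pull-back
identity `φ^*h = ψ^*g_{M,a}` bounds the Gram determinant of `h ∘ dφ`, `√det h_{ij} ≥ 1/2` far out, so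
`coord ∘ φ` has bounded Jacobian on a bounded set while its image contains the exterior of a ball —
contradicting `addHaar_image_le_lintegral_abs_det_fderiv`); in the second case `X ∖ φ({R < r})` is a closed
subset of the compact complement of a far region (`AFEnd.IsSoleEnd.isCompact_compl_far`).

References: R. Bartnik, CPAM 39 (1986), §3; R. Schoen, S.-T. Yau, CMP 65 (1979), §1; D. Christodoulou,
CQG 16 (1999), p. A24 (the admissible class).
-/

set_option linter.dupNamespace false

noncomputable section

open Set Filter Function MeasureTheory Metric
open scoped Manifold ContDiff Topology ENNReal
open Literature.Geometry.Lorentzian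
open Summit.FinalStateConjecture.FinalStateConjecture.Theorems.KerrShieldedDataExist.Negative
  (bentHeight graph coe_graph psi_eq_graph bentHeight_eq_zero_of_le rPlus_lt_four_mul mass_pos rMinus_nonneg)

namespace Summit.FinalStateConjecture.FinalStateConjecture.Theorems.SwallowTheDatum.KerrShieldedSettles

namespace ScriTransport

section CapLemmas

variable {X : Type} [TopologicalSpace X] [ChartedSpace E3 X] [IsManifold (𝓡 3) ∞ X]

/-- **The chart components evaluate the metric, bilinear form** (polarised `hCoeff_coord_mfderiv`):
`h_ij(coord q)(dcoord v, dcoord w) = h_q(v, w)` on the end. [cite: Bartnik1986, (1.3)] -/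
theorem hCoeff_coord_mfderiv₂ (e : AFEnd X) (D : InitialDataSet (𝓡 3) X) (q : e.U)
    (v w : TangentSpace (𝓡 3) (q : X)) :
    AFEnd.hCoeff e D (e.coord q) (mfderiv (𝓡 3) 𝓘(ℝ, E3) e.coord q v)
      (mfderiv (𝓡 3) 𝓘(ℝ, E3) e.coord q w) = D.h.inner q v w := by
  rw [e.mfderiv_coord_comp_val q v, e.mfderiv_coord_comp_val q w, e.coord_of_mem q.2, e.hCoeff_coe D]
  have key : ∀ (p : X) (_ : p = (q : X)) (v' : E3) (_ : v' = v) (w' : E3) (_ : w' = w),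
      D.h.inner p v' w' = D.h.inner q v w := by
    rintro p rfl v' rfl w' rfl; rfl
  exact key _ (e.dataChart_chart q) _ (e.mfderiv_dataChart_mfderiv_chart q v) _ (e.mfderiv_dataChart_mfderiv_chart q w)

variable {M a r₁ : ℝ}

/-- **Near the inner edge the bent leaf is the flat slice**: at a slice point with `r < 4M` the graph
`y ↦ (T(r y), y)` has differential `v ↦ (0, v)` (`T ≡ 0` on `{r ≤ 4M}`, `bentHeight_eq_zero_of_le`, so the
graph agrees with `Kerr.sliceEmbed` near the point; `Kerr.mfderiv_sliceEmbed_apply`). [folklore] -/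
theorem mfderiv_graph_of_lt (hM : 0 < M) {y : Kerr.slice a r₁}
    (hy : Kerr.radius a (E4.ofTimeSpace 0 (y : E3)) < 4 * M) (v : E3) :
    mfderiv 𝓘(ℝ, E3) 𝓘(ℝ, E4) (graph M a r₁) y v = E4.ofTimeSpace 0 v := by
  have hev : graph M a r₁ =ᶠ[𝓝 y] Kerr.sliceEmbed a r₁ := by
    have hopen : IsOpen {y' : Kerr.slice a r₁ | Kerr.radius a (E4.ofTimeSpace 0 (y' : E3)) < 4 * M} :=
      isOpen_lt ((Kerr.continuous_radius a).comp ((E4.continuous_ofTimeSpace 0).comp continuous_subtype_val))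
        continuous_const
    filter_upwards [hopen.mem_nhds hy] with y' hy'
    apply Subtype.ext
    rw [coe_graph, Kerr.coe_sliceEmbed, bentHeight_eq_zero_of_le hM hy'.le]
  rw [hev.mfderiv_eq]
  exact Kerr.mfderiv_sliceEmbed_apply a r₁ y v

/-- The closed slab `{ρ ≤ r(0, y) ≤ R'}` of `E3` is compact (closed; bounded by `‖y‖ ≤ r + |a|`). [folklore] -/
theorem isCompact_radius_slab (a ρ R' : ℝ) :
    IsCompact {y : E3 | ρ ≤ Kerr.radius a (E4.ofTimeSpace 0 y) ∧ Kerr.radius a (E4.ofTimeSpace 0 y) ≤ R'} := by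
  have hcont : Continuous fun y : E3 ↦ Kerr.radius a (E4.ofTimeSpace 0 y) :=
    (Kerr.continuous_radius a).comp (E4.continuous_ofTimeSpace 0)
  refine Metric.isCompact_of_isClosed_isBounded ?_ ?_
  · exact (isClosed_le continuous_const hcont).inter (isClosed_le hcont continuous_const)
  · refine (Metric.isBounded_closedBall (x := (0 : E3)) (r := R' + |a|)).subset fun y hy ↦ ?_
    rw [Metric.mem_closedBall, dist_zero_right]
    have h := KerrLeafSojourn.spatialNorm_sub_le_radius a (E4.ofTimeSpace 0 y)
    rw [E4.spatialNorm_ofTimeSpace] at h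
    linarith [hy.2]

/-- **The entries of the Kerr–Schild form on the flat slice are uniformly bounded on `{r₁ ≤ r ≤ ρ}`**
(`r₁ > 0`): continuity of `x ↦ g_{M,a}(x)` on `{r > 0}` (`Kerr.contDiffAt_bilin`) and compactness of the
closed, bounded (`‖y‖ ≤ r + |a|`) set `{r₁ ≤ r(0, y) ≤ ρ}`. [folklore] -/
theorem exists_bound_bilin (M a : ℝ) (h0 : 0 < r₁) (ρ : ℝ) {ι : Type*} [Fintype ι] (V : ι → E4) :
    ∃ Λ : ℝ, ∀ y : E3, r₁ ≤ Kerr.radius a (E4.ofTimeSpace 0 y) → Kerr.radius a (E4.ofTimeSpace 0 y) ≤ ρ →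
      ∀ i j, |Kerr.bilin M a (E4.ofTimeSpace 0 y) (V i) (V j)| ≤ Λ := by
  set K : Set E3 := {y | r₁ ≤ Kerr.radius a (E4.ofTimeSpace 0 y) ∧ Kerr.radius a (E4.ofTimeSpace 0 y) ≤ ρ}
  have hKc : IsCompact K := isCompact_radius_slab a r₁ ρ
  set F : E3 → ℝ := fun y ↦ ∑ i, ∑ j, |Kerr.bilin M a (E4.ofTimeSpace 0 y) (V i) (V j)| with hF
  have hKcont : ContinuousOn F K := by
    refine continuousOn_finsetSum _ fun i _ ↦ continuousOn_finsetSum _ fun j _ y hy ↦ ?_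
    have hr : 0 < Kerr.radius a (E4.ofTimeSpace 0 y) := h0.trans_le hy.1
    have h1 : ContinuousAt (fun y : E3 ↦ Kerr.bilin M a (E4.ofTimeSpace 0 y)) y :=
      (Kerr.contDiffAt_bilin M a hr (n := 0)).continuousAt.comp (E4.continuous_ofTimeSpace 0).continuousAt
    exact ((h1.clm_apply continuousAt_const).clm_apply continuousAt_const).abs.continuousWithinAt
  obtain ⟨Λ, hΛ⟩ := hKc.bddAbove_image hKcont
  refine ⟨Λ, fun y h₁ h₂ i j ↦ le_trans ?_ (hΛ ⟨y, ⟨h₁, h₂⟩, rfl⟩)⟩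
  calc |Kerr.bilin M a (E4.ofTimeSpace 0 y) (V i) (V j)|
      ≤ ∑ j', |Kerr.bilin M a (E4.ofTimeSpace 0 y) (V i) (V j')| :=
        Finset.single_le_sum (f := fun j' ↦ |Kerr.bilin M a (E4.ofTimeSpace 0 y) (V i) (V j')|)
          (fun _ _ ↦ abs_nonneg _) (Finset.mem_univ j)
    _ ≤ F y := Finset.single_le_sum (f := fun i' ↦ ∑ j', |Kerr.bilin M a (E4.ofTimeSpace 0 y) (V i') (V j')|)
          (fun _ _ ↦ Finset.sum_nonneg fun _ _ ↦ abs_nonneg _) (Finset.mem_univ i)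

/-- Entrywise bound for a real `3 × 3` determinant: `|det A| ≤ 6 Λ³` when `|Aᵢⱼ| ≤ Λ` (`Matrix.det_le`). [folklore] -/
theorem abs_det_le_of_entries {A : Matrix (Fin 3) (Fin 3) ℝ} {Λ : ℝ} (h : ∀ i j, |A i j| ≤ Λ) :
    |A.det| ≤ 6 * Λ ^ 3 := by
  have := Matrix.det_le (A := A) (abv := AbsoluteValue.abs) (x := Λ) h
  simpa [Fintype.card_fin, Nat.factorial, nsmul_eq_mul] using this

/-- **The far regions of the admissible end are not swallowed by the inner collar of the shield.**  Let the
end `e` of `X` be asymptotically flat of order `1` in the metric, and let `φ : Kerr.slice a r₁ → X` be smooth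
with the shield's pull-back identity `h(dφ v, dφ w) = g_{M,a}(dψ v, dψ w)` for the bent leaf `ψ = graph M a r₁`
(`0 < r₁`, `0 < M`).  Then for `ρ ≤ 4M` no far region `e.far t` (`t ≥ R(e)`) is contained in
`φ({y | r y < ρ})`.  Proof by volume, as in the tree's `not_far_subset_normLt` (Bartnik's "two structures of
infinity"): on the bounded set `s = {y | r y < ρ, φ y ∈ far t'}` the map `S = coord ∘ φ : s → ℝ³` is `C¹` with
`det (h_K(y)(bᵢ, bⱼ)) = (det DS)² det (h_{ij}(S y))`, `h_K = ψ^* g` the (bounded, flat-time Kerr–Schild) leaf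
metric, so `|det DS| ≤ C` there (`√det h_{ij} ≥ 1/2` far out), while `S(s) ⊇ {t' < ‖z‖}` has infinite Lebesgue
measure — contradicting `Leb(S(s)) ≤ ∫_s |det DS|` (Mathlib's `addHaar_image_le_lintegral_abs_det_fderiv`).
[cite: Bartnik1986, §3 (structures of infinity of the same end)] -/
theorem not_far_subset_image [Kerr.Facts] {e : AFEnd X} {D : InitialDataSet (𝓡 3) X}
    (hAF : e.IsMetricAsymptoticallyFlat D 1) (hM : 0 < M) (h0 : 0 < r₁) {φ : Kerr.slice a r₁ → X}
    (hφs : ContMDiff 𝓘(ℝ, E3) (𝓡 3) ∞ φ)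
    (hh : ∀ (y : Kerr.slice a r₁) (v w : E3),
      D.h.inner (φ y) (mfderiv 𝓘(ℝ, E3) (𝓡 3) φ y v) (mfderiv 𝓘(ℝ, E3) (𝓡 3) φ y w) =
        Kerr.bilin M a (graph M a r₁ y : E4) (mfderiv 𝓘(ℝ, E3) 𝓘(ℝ, E4) (graph M a r₁) y v)
          (mfderiv 𝓘(ℝ, E3) 𝓘(ℝ, E4) (graph M a r₁) y w))
    {ρ : ℝ} (hρ : ρ ≤ 4 * M) {t : ℝ} (ht : e.R ≤ t) :
    ¬ e.far t ⊆ φ '' {y : Kerr.slice a r₁ | Kerr.radius a (E4.ofTimeSpace 0 (y : E3)) < ρ} := by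
  classical
  intro hsub
  obtain ⟨R₃, hR₃⟩ := e.exists_radius_half_le_sqrt_det_hCoeff D one_pos hAF
  set b : Module.Basis (Fin 3) ℝ E3 := (EuclideanSpace.basisFun (Fin 3) ℝ).toBasis with hb
  have hbi : ∀ i, b i = EuclideanSpace.single i 1 := fun i ↦ by
    rw [hb, OrthonormalBasis.coe_toBasis, EuclideanSpace.basisFun_apply]
  obtain ⟨Λ, hΛ⟩ := exists_bound_bilin (r₁ := r₁) M a h0 ρ (fun i : Fin 3 ↦ E4.ofTimeSpace 0 (b i))
  -- the composite `S = coord ∘ φ`, read on `E3`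
  set f : Kerr.slice a r₁ → E3 := fun y ↦ e.coord (φ y) with hf
  set S : E3 → E3 := fun y ↦ if hy : y ∈ Kerr.slice a r₁ then f ⟨y, hy⟩ else 0 with hS
  set S' : E3 → E3 →L[ℝ] E3 := fun y ↦
    if hy : y ∈ Kerr.slice a r₁ then mfderiv 𝓘(ℝ, E3) 𝓘(ℝ, E3) f ⟨y, hy⟩ else 0 with hS'
  have hfS : ∀ y : Kerr.slice a r₁, f y = S y := fun y ↦ by rw [hS]; dsimp only; rw [dif_pos y.2]
  set t' : ℝ := max t R₃ with ht'
  set sK : Set (Kerr.slice a r₁) :=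
    {y | Kerr.radius a (E4.ofTimeSpace 0 (y : E3)) < ρ ∧ φ y ∈ e.far t'} with hsK
  set s : Set E3 := Subtype.val '' sK with hs
  -- `s` is open
  have hsKo : IsOpen sK :=
    (isOpen_lt ((Kerr.continuous_radius a).comp ((E4.continuous_ofTimeSpace 0).comp continuous_subtype_val))
      continuous_const).inter ((e.isOpen_far t').preimage hφs.continuous)
  have hso : IsOpen s := (Kerr.slice a r₁).isOpen.isOpenMap_subtype_val _ hsKo
  -- the image of `s` contains the exterior of the ball of radius `t'`
  have himg : {z : E3 | t' < ‖z‖} ⊆ S '' s := by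
    intro z hz
    have hzR : e.R < ‖z‖ := lt_of_le_of_lt (ht.trans (le_max_left _ _)) hz
    have hq : e.dataChartExt z ∈ e.far t' := by
      rw [e.dataChartExt_of_lt hzR]
      exact e.mem_far_iff.2 ⟨⟨z, hzR⟩, hz, rfl⟩
    obtain ⟨y, hy, hyq⟩ := hsub (e.far_mono (le_max_left _ _) hq)
    refine ⟨y, ⟨y, ⟨hy, hyq ▸ hq⟩, rfl⟩, ?_⟩
    rw [← hfS, hf]
    dsimp only
    rw [hyq, e.dataChartExt_of_lt hzR, e.coord_dataChart]
  -- points of `sK` lie in the end, with large coordinate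
  have hU : ∀ y ∈ sK, φ y ∈ e.U := fun y hy ↦ (e.mem_far_iff_coord.1 hy.2).1
  have hnorm : ∀ y ∈ sK, R₃ ≤ ‖S y‖ := fun y hy ↦ by
    obtain ⟨hyU, hlt⟩ := e.mem_far_iff_coord.1 hy.2
    rw [← hfS]
    exact (le_max_right t R₃).trans hlt.le
  -- differentiability of `S` on `s`, with derivative `S'`
  have hfd : ∀ y ∈ sK, MDifferentiableAt 𝓘(ℝ, E3) 𝓘(ℝ, E3) f y ∧
      mfderiv 𝓘(ℝ, E3) 𝓘(ℝ, E3) f y =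
        (mfderiv (𝓡 3) 𝓘(ℝ, E3) e.coord (φ y)).comp (mfderiv 𝓘(ℝ, E3) (𝓡 3) φ y) := by
    intro y hy
    have h1 : MDifferentiableAt 𝓘(ℝ, E3) (𝓡 3) φ y := (hφs y).mdifferentiableAt (by simp)
    have h2 : MDifferentiableAt (𝓡 3) 𝓘(ℝ, E3) e.coord (φ y) :=
      (e.contMDiffAt_coord (hU y hy)).mdifferentiableAt (by simp)
    exact ⟨h2.comp y h1, mfderiv_comp y h2 h1⟩
  have hSd : ∀ y ∈ s, HasFDerivAt S (S' y) y := by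
    rintro _ ⟨y, hy, rfl⟩
    have hd : DifferentiableAt ℝ S (y : E3) :=
      (OpensChart.mdifferentiableAt_iff y f S hfS).1 (hfd y hy).1
    have h3 : S' y = mfderiv 𝓘(ℝ, E3) 𝓘(ℝ, E3) f y := by rw [hS']; dsimp only; rw [dif_pos y.2]
    rw [h3, OpensChart.mfderiv_eq y f S hfS hd]
    exact hd.hasFDerivAt
  -- the Gram identity and the Jacobian bound on `s`
  have hjac : ∀ y ∈ sK, |(S' y).det| ≤ Real.sqrt (24 * |Λ| ^ 3) := by
    intro y hy
    have hyU := hU y hy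
    have h3 : S' y = mfderiv 𝓘(ℝ, E3) 𝓘(ℝ, E3) f y := by rw [hS']; dsimp only; rw [dif_pos y.2]
    -- `h_{ij}(S y)(S' v, S' w) = g_{M,a}(ψ y)(dψ v, dψ w)`
    have hco : ∀ v w : E3, AFEnd.hCoeff e D (S y) (S' y v) (S' y w) =
        Kerr.bilin M a (E4.ofTimeSpace 0 (y : E3)) (E4.ofTimeSpace 0 v) (E4.ofTimeSpace 0 w) := by
      intro v w
      have hy4 : Kerr.radius a (E4.ofTimeSpace 0 (y : E3)) < 4 * M := lt_of_lt_of_le hy.1 hρ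
      have key := hCoeff_coord_mfderiv₂ e D ⟨φ y, hyU⟩ (mfderiv 𝓘(ℝ, E3) (𝓡 3) φ y v)
        (mfderiv 𝓘(ℝ, E3) (𝓡 3) φ y w)
      have e1 : AFEnd.hCoeff e D (S y) (S' y v) (S' y w) =
          D.h.inner (φ y) (mfderiv 𝓘(ℝ, E3) (𝓡 3) φ y v) (mfderiv 𝓘(ℝ, E3) (𝓡 3) φ y w) := by
        rw [h3, (hfd y hy).2, ← hfS y]
        exact key
      rw [e1, hh y v w, mfderiv_graph_of_lt hM hy4, mfderiv_graph_of_lt hM hy4, coe_graph,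
        bentHeight_eq_zero_of_le hM hy4.le]
    -- Gram: `det (g_K(bᵢ, bⱼ)) = (det S')² det (h_{ij}(S y)(bᵢ, bⱼ))`
    set B : LinearMap.BilinForm ℝ E3 := (AFEnd.hCoeff e D (S y)).toLinearMap₁₂ with hB
    have hgram := det_gram_comp b B (S' y : E3 →ₗ[ℝ] E3)
    have hG : (Matrix.of fun i j ↦ B ((S' y : E3 →ₗ[ℝ] E3) (b i)) ((S' y : E3 →ₗ[ℝ] E3) (b j))) =
        Matrix.of fun i j ↦ Kerr.bilin M a (E4.ofTimeSpace 0 (y : E3)) (E4.ofTimeSpace 0 (b i))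
          (E4.ofTimeSpace 0 (b j)) := by
      ext i j
      rw [Matrix.of_apply, Matrix.of_apply, hB, ContinuousLinearMap.toLinearMap₁₂_apply]
      exact hco (b i) (b j)
    have hH : (Matrix.of fun i j ↦ B (b i) (b j)) = Matrix.of fun i j ↦
        AFEnd.hCoeff e D (S y) (EuclideanSpace.single i 1) (EuclideanSpace.single j 1) := by
      ext i j
      rw [Matrix.of_apply, Matrix.of_apply, hB, ContinuousLinearMap.toLinearMap₁₂_apply, hbi, hbi]
    rw [hG, hH] at hgram
    -- bounds: `|det g_K| ≤ 6 |Λ|³`, `det h_{ij} ≥ 1/4`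
    have hr₁y : r₁ ≤ Kerr.radius a (E4.ofTimeSpace 0 (y : E3)) :=
      ((le_max_left _ _).trans_lt (Kerr.mem_slice.1 y.2)).le
    have hup : |(Matrix.of fun i j ↦ Kerr.bilin M a (E4.ofTimeSpace 0 (y : E3)) (E4.ofTimeSpace 0 (b i))
        (E4.ofTimeSpace 0 (b j))).det| ≤ 6 * |Λ| ^ 3 :=
      abs_det_le_of_entries fun i j ↦ (hΛ y hr₁y hy.1.le i j).trans (le_abs_self Λ)
    have hlow : (1 : ℝ) / 4 ≤ (Matrix.of fun i j ↦
        AFEnd.hCoeff e D (S y) (EuclideanSpace.single i 1) (EuclideanSpace.single j 1)).det := by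
      have h := hR₃ (S y) (hnorm y hy)
      have h' := (Real.le_sqrt' (by norm_num : (0 : ℝ) < 1 / 2)).1 h
      nlinarith
    have hsq : (S' y).det ^ 2 ≤ 24 * |Λ| ^ 3 := by
      have hdet : (S' y).det = LinearMap.det (S' y : E3 →ₗ[ℝ] E3) := rfl
      rw [hdet]
      have h1 : LinearMap.det (S' y : E3 →ₗ[ℝ] E3) ^ 2 * (Matrix.of fun i j ↦
          AFEnd.hCoeff e D (S y) (EuclideanSpace.single i 1) (EuclideanSpace.single j 1)).det ≤
          6 * |Λ| ^ 3 := by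
        rw [← hgram]; exact (le_abs_self _).trans hup
      have h2 := mul_le_mul_of_nonneg_left hlow (sq_nonneg (LinearMap.det (S' y : E3 →ₗ[ℝ] E3)))
      nlinarith
    exact Real.abs_le_sqrt hsq
  -- change of variables: the image of the bounded set `s` has finite measure …
  have hsm : MeasurableSet s := hso.measurableSet
  have hcov := MeasureTheory.addHaar_image_le_lintegral_abs_det_fderiv (volume : Measure E3) hsm
    (fun y hy ↦ (hSd y hy).hasFDerivWithinAt)
  have hsball : s ⊆ ball (0 : E3) (ρ + |a| + 1) := by
    rintro _ ⟨y, hy, rfl⟩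
    rw [mem_ball_zero_iff]
    have h := KerrLeafSojourn.spatialNorm_sub_le_radius a (E4.ofTimeSpace 0 (y : E3))
    rw [E4.spatialNorm_ofTimeSpace] at h
    linarith [hy.1]
  have hfin : ∫⁻ y in s, ENNReal.ofReal |(S' y).det| < ⊤ := by
    calc ∫⁻ y in s, ENNReal.ofReal |(S' y).det|
        ≤ ∫⁻ _ in s, ENNReal.ofReal (Real.sqrt (24 * |Λ| ^ 3)) := by
          refine setLIntegral_mono' hsm fun z hz ↦ ENNReal.ofReal_le_ofReal ?_
          obtain ⟨y, hy, rfl⟩ := hz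
          exact hjac y hy
      _ = ENNReal.ofReal (Real.sqrt (24 * |Λ| ^ 3)) * volume s := setLIntegral_const _ _
      _ ≤ ENNReal.ofReal (Real.sqrt (24 * |Λ| ^ 3)) * volume (ball (0 : E3) (ρ + |a| + 1)) := by
          gcongr
      _ < ⊤ := ENNReal.mul_lt_top ENNReal.ofReal_lt_top measure_ball_lt_top
  -- … but contains the exterior of a ball
  have hinf : volume (S '' s) = ⊤ := by
    apply eq_top_iff.2
    rw [← volume_compl_closedBall_eq_top t']
    refine measure_mono (Subset.trans (fun z hz ↦ ?_) himg)
    have hz' : ¬ ‖z‖ ≤ t' := by simpa [mem_closedBall, dist_zero_right] using hz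
    exact not_le.1 hz'
  rw [hinf] at hcov
  exact absurd (top_le_iff.1 hcov) hfin.ne

/-- **Inner-edge capping.**  For an ADMISSIBLE datum (sole, DR-asymptotically flat end `e`), a shield chart
`φ : Kerr.slice a r₁ → X` (smooth open embedding, compact co-range, pull-back identity with the bent leaf,
sub-extremal `(M, a)`, `r₋ < r₁ < r₊`) and every radius `R`, the complement of `φ({y | R < r y})` is COMPACT.
Far regions of `e` are preconnected and eventually avoid the compact set `(range φ)ᶜ ∪ φ({ρ ≤ r ≤ R})`
(`r₁ < ρ < r₊ ≤ 4M`), hence lie in `φ({r < ρ})` or in `φ({R < r})`; the first is excluded by volume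
(`not_far_subset_image`), and in the second case the complement of `φ({R < r})` is a closed subset of the
compact complement of a far region (`IsSoleEnd.isCompact_compl_far`).  This is where admissibility is
load-bearing (Disproof.lean §H1: the coreless slice is a counterexample).
[cite: Bartnik1986, §3 (structures of infinity of the same end)] -/
theorem isCompact_compl_image_far [Kerr.Facts] [T2Space X] {D : InitialDataSet (𝓡 3) X}
    (hD : D ∈ admissibleVacuumData X) (ha : |a| < M) (hr₁ : Kerr.rMinus M a < r₁)
    (hr₂ : r₁ < Kerr.rPlus M a) {φ : Kerr.slice a r₁ → X} (hK : IsCompact (Set.range φ)ᶜ)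
    (hφo : Topology.IsOpenEmbedding φ) (hφs : ContMDiff 𝓘(ℝ, E3) (𝓡 3) ∞ φ)
    (hh : ∀ (y : Kerr.slice a r₁) (v w : E3),
      D.h.inner (φ y) (mfderiv 𝓘(ℝ, E3) (𝓡 3) φ y v) (mfderiv 𝓘(ℝ, E3) (𝓡 3) φ y w) =
        Kerr.bilin M a (graph M a r₁ y : E4) (mfderiv 𝓘(ℝ, E3) 𝓘(ℝ, E4) (graph M a r₁) y v)
          (mfderiv 𝓘(ℝ, E3) 𝓘(ℝ, E4) (graph M a r₁) y w))
    (R : ℝ) :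
    IsCompact (φ '' {y : Kerr.slice a r₁ | R < Kerr.radius a (E4.ofTimeSpace 0 (y : E3))})ᶜ := by
  have hM0 : 0 < M := mass_pos ha
  have h0 : 0 < r₁ := (rMinus_nonneg ha).trans_lt hr₁
  obtain ⟨e, hsole, M', hSAF⟩ := exists_isSoleEnd_of_mem_admissibleVacuumData hD
  have hAF : e.IsMetricAsymptoticallyFlat D 1 :=
    (AFEnd.IsStronglyAsymptoticallyFlatDR.IsAsymptoticallyFlat_one_holds e D hSAF).isMetricAsymptoticallyFlat
  have hcont : Continuous fun y : Kerr.slice a r₁ ↦ Kerr.radius a (E4.ofTimeSpace 0 (y : E3)) :=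
    (Kerr.continuous_radius a).comp ((E4.continuous_ofTimeSpace 0).comp continuous_subtype_val)
  -- an intermediate radius `r₁ < ρ ≤ 4M`
  set ρ : ℝ := (r₁ + Kerr.rPlus M a) / 2 with hρ
  have hρ₁ : r₁ < ρ := by rw [hρ]; linarith
  have hρ4 : ρ ≤ 4 * M := by have := rPlus_lt_four_mul ha; rw [hρ]; linarith
  -- it suffices to treat radii `R' ≥ ρ`
  suffices H : ∀ R', ρ ≤ R' →
      IsCompact (φ '' {y : Kerr.slice a r₁ | R' < Kerr.radius a (E4.ofTimeSpace 0 (y : E3))})ᶜ by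
    refine (H (max R ρ) (le_max_right _ _)).of_isClosed_subset ?_ (compl_subset_compl.2
      (Set.image_mono fun y (hy : max R ρ < _) ↦ show R < _ from lt_of_le_of_lt (le_max_left _ _) hy))
    exact (hφo.isOpenMap _ (isOpen_lt continuous_const hcont)).isClosed_compl
  intro R' hR'
  -- the compact set avoided by far regions
  set Kmid : Set (Kerr.slice a r₁) := {y | ρ ≤ Kerr.radius a (E4.ofTimeSpace 0 (y : E3)) ∧
    Kerr.radius a (E4.ofTimeSpace 0 (y : E3)) ≤ R'} with hKmid
  have hKmidc : IsCompact Kmid := by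
    rw [Topology.IsEmbedding.subtypeVal.isCompact_iff]
    convert isCompact_radius_slab a ρ R' using 1
    ext z
    constructor
    · rintro ⟨y, hy, rfl⟩; exact hy
    · intro hz
      exact ⟨⟨z, Kerr.mem_slice.2 (by rw [max_eq_left h0.le]; exact hρ₁.trans_le hz.1)⟩, hz, rfl⟩
  set C : Set X := (Set.range φ)ᶜ ∪ φ '' Kmid with hC
  have hCc : IsCompact C := hK.union (hKmidc.image hφo.continuous)
  obtain ⟨T₀, hT₀⟩ := e.exists_forall_far_disjoint hCc
  set t : ℝ := max T₀ e.R with ht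
  have hdisj := hT₀ t (le_max_left _ _)
  -- the two open pieces
  set A : Set X := φ '' {y : Kerr.slice a r₁ | Kerr.radius a (E4.ofTimeSpace 0 (y : E3)) < ρ} with hA
  set B : Set X := φ '' {y : Kerr.slice a r₁ | R' < Kerr.radius a (E4.ofTimeSpace 0 (y : E3))} with hB
  have hAo : IsOpen A := hφo.isOpenMap _ (isOpen_lt hcont continuous_const)
  have hBo : IsOpen B := hφo.isOpenMap _ (isOpen_lt continuous_const hcont)
  have hAB : Disjoint A B := by
    rw [Set.disjoint_left]
    rintro _ ⟨y, hy, rfl⟩ ⟨y', hy', he⟩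
    have : y' = y := hφo.injective he
    subst this
    have h1 : Kerr.radius a (E4.ofTimeSpace 0 (y' : E3)) < ρ := hy
    have h2 : R' < Kerr.radius a (E4.ofTimeSpace 0 (y' : E3)) := hy'
    linarith
  have hcover : e.far t ⊆ A ∪ B := by
    intro q hq
    have hqC : q ∉ C := fun h ↦ Set.disjoint_left.1 hdisj hq h
    have hq1 : q ∈ Set.range φ := not_not.1 fun h ↦ hqC (Or.inl h)
    obtain ⟨y, rfl⟩ := hq1
    have hy : y ∉ Kmid := fun h ↦ hqC (Or.inr ⟨y, h, rfl⟩)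
    by_cases h1 : Kerr.radius a (E4.ofTimeSpace 0 (y : E3)) < ρ
    · exact Or.inl ⟨y, h1, rfl⟩
    · refine Or.inr ⟨y, ?_, rfl⟩
      by_contra h2
      exact hy ⟨not_lt.1 h1, not_lt.1 h2⟩
  rcases (e.isPreconnected_far (le_max_right _ _)).subset_or_subset hAo hBo hAB hcover with h | h
  · exact absurd h (not_far_subset_image hAF hM0 h0 hφs hh hρ4 (le_max_right _ _))
  · exact (hsole.isCompact_compl_far t).of_isClosed_subset hBo.isClosed_compl (compl_subset_compl.2 h)

end CapLemmas

end ScriTransport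

open ScriTransport in
/-- **Registered sub-goal `stub_scriTransportCapping` — inner-edge capping of the shield.**  For an admissible
datum `D` on `X` (complete, one sole asymptotically flat end) shielded by `(M, a, r₁, φ, ψ)` — sub-extremal
`(M, a)`, `r₋ < r₁ < r₊`, `φ : Kerr.slice a r₁ → X` a smooth open embedding with compact co-range, `ψ` the graph
of `T = bentHeight M a`, and the pull-back identity `h(dφ v, dφ w) = g_{M,a}(dψ v, dψ w)` — the complement in `X`
of `φ({y | R < r y})` is compact for every radius `R`: the sets `B₀`, `B₁` of clause (a) of the crux.  This is
exactly where admissibility enters stub S5 (`ScriTransport.isCompact_compl_image_far`; Disproof.lean §H1/§H3).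
[cite: Bartnik1986, §3 (structures of infinity of the same end)] -/
theorem stub_scriTransportCapping : ∀ [Kerr.Facts] (X : Type) [TopologicalSpace X] [ChartedSpace E3 X]
    [IsManifold (𝓡 3) ((⊤ : ℕ∞) : WithTop ℕ∞) X] [T2Space X] (D : InitialDataSet (𝓡 3) X),
    D ∈ admissibleVacuumData X →
    ∀ (M a r₁ : ℝ) (φ : Kerr.slice a r₁ → X) (ψ : Kerr.slice a r₁ → Kerr.region a r₁),
    |a| < M → Kerr.rMinus M a < r₁ → r₁ < Kerr.rPlus M a →
    IsCompact (Set.range φ)ᶜ → Topology.IsOpenEmbedding φ →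
    ContMDiff 𝓘(ℝ, E3) (𝓡 3) ((⊤ : ℕ∞) : WithTop ℕ∞) φ →
    (∀ y : Kerr.slice a r₁, (ψ y : E4) = E4.ofTimeSpace
      (Summit.FinalStateConjecture.FinalStateConjecture.Theorems.KerrShieldedDataExist.Negative.bentHeight M a
        (Kerr.radius a (E4.ofTimeSpace 0 (y : E3)))) (y : E3)) →
    (∀ (y : Kerr.slice a r₁) (v w : E3),
        D.h.inner (φ y) (mfderiv 𝓘(ℝ, E3) (𝓡 3) φ y v) (mfderiv 𝓘(ℝ, E3) (𝓡 3) φ y w) =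
          Kerr.bilin M a (ψ y : E4) (mfderiv 𝓘(ℝ, E3) 𝓘(ℝ, E4) ψ y v)
            (mfderiv 𝓘(ℝ, E3) 𝓘(ℝ, E4) ψ y w)) →
    ∀ R : ℝ, IsCompact (φ '' {y : Kerr.slice a r₁ | R < Kerr.radius a (E4.ofTimeSpace 0 (y : E3))})ᶜ := by
  intro _ X _ _ _ _ D hD M a r₁ φ ψ ha hr₁ hr₂ hK hφo hφs hψ hh R
  obtain rfl : ψ = graph M a r₁ := psi_eq_graph rfl hψ
  exact isCompact_compl_image_far hD ha hr₁ hr₂ hK hφo hφs hh R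

end Summit.FinalStateConjecture.FinalStateConjecture.Theorems.SwallowTheDatum.KerrShieldedSettles

end
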